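import Summits.KontsevichZagierPeriods.KontsevichZagierPeriods.Theorems.SoloInformedAlgCone
import HarnessLib

/-!
# The DEN-calculus over `K`: normalisation of a vertex germ

Solo programme `solo-KontsevichZagierPeriods-informed`, session s107, step (x-l) of the general
two-dimensional algorithm.  With `m = k + 1` the multiplicity of `F` at `0`:

* invariance of the vertex-germ property under equal values, non-zero constants and the swap, and
  **RULE NORMALISE** `soloInformed_vertexGermOK_of_xScale`: `F` has the vertex-germ property if
  `F(λ₀x₀, x₁)` has it (`0 < λ₀ < 1`; RULE SPLIT in the direction `x₀`, the far piece is a leaf);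
* coefficients, support and cone polynomial of the rescaled `F(λ₀x₀, x₁)`, and the values of its
  blow-up chart and child germs in terms of those of `F`;
The two combinatorial cases themselves (pure cone, mixed cone) follow in `SoloInformedAlgConeCases`.

References: J. Kollár, *Lectures on Resolution of Singularities* (2007), §1.10;
M. Kontsevich, D. Zagier, *Periods* (2001), §1.2.
-/

noncomputable section

open scoped BigOperators
open MeasureTheory Set Polynomial
open Literature.NumberTheory.Transcendental Literature.NumberTheory.Transcendental.KZ

namespace Summit.KontsevichZagierPeriods.KontsevichZagierPeriods.Theorems

variable {K : Type*} [Field K] [Algebra K ℝ]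

/-! ### Invariances of the vertex-germ property -/

/-- The vertex-germ property depends only on the values. [this work] -/
theorem soloInformed_vertexGermOK_congr {F F' : MvPolynomial (Fin 2) K}
    (h : ∀ y : Fin 2 → ℝ, (MvPolynomial.aeval y F : ℝ) = MvPolynomial.aeval y F')
    (hF : SoloInformedVertexGermOK F) : SoloInformedVertexGermOK F' := by
  intro e u U hu hU hF'
  refine soloInformed_presentableDenK_congr (fun x _ => by rw [map_mul, map_mul, map_mul, map_mul, h])
    (hF e u U hu hU fun y hy hy0 => ?_)
  rw [h]; exact hF' y hy hy0

/-- The vertex-germ property is invariant under constants. [this work] -/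
theorem soloInformed_vertexGermOK_C_mul {F : MvPolynomial (Fin 2) K} {c : K}
    (hF : SoloInformedVertexGermOK F) : SoloInformedVertexGermOK (MvPolynomial.C c * F) := by
  intro e u U hu hU hF'
  have hF0 : ∀ y ∈ soloInformedCube 2, y ≠ 0 → (MvPolynomial.aeval y F : ℝ) ≠ 0 := by
    intro y hy hy0 h
    refine hF' y hy hy0 ?_
    rw [map_mul, MvPolynomial.aeval_C, h, mul_zero]
  refine soloInformed_presentableDenK_congr (fun x _ => ?_)
    (soloInformed_presentableDenK_C_mul c (hF e u U hu hU hF0))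
  simp only [map_mul, MvPolynomial.aeval_C]
  ring

/-- The vertex-germ property of `F` follows from that of its swap. [this work] -/
theorem soloInformed_vertexGermOK_of_swapK (hK : ∀ c : K, IsAlgebraic ℚ (algebraMap K ℝ c))
    {F : MvPolynomial (Fin 2) K} (hF : SoloInformedVertexGermOK (soloInformedSwapK F)) :
    SoloInformedVertexGermOK F := by
  intro e u U hu hU hF'
  have hQ : ∀ x ∈ soloInformedOpenCube 2,
      (MvPolynomial.aeval x (MvPolynomial.monomial e u * (U * F)) : ℝ) ≠ 0 := fun x hx => by
    rw [map_mul, map_mul, soloInformed_aevalK_monomial]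
    exact mul_ne_zero (mul_ne_zero ((_root_.map_ne_zero _).2 hu)
      (Finset.prod_ne_zero_iff.2 fun j _ => pow_ne_zero _ (hx j).1.ne'))
      (mul_ne_zero (hU x (soloInformedOpenCube_subset_cube 2 hx))
        (hF' x (soloInformedOpenCube_subset_cube 2 hx) fun h => (hx 0).1.ne' (by rw [h]; rfl)))
  refine soloInformed_presentableDenK_of_swap hK hQ ?_
  have hU' : ∀ y ∈ soloInformedCube 2,
      (MvPolynomial.aeval y (soloInformedSwapK U) : ℝ) ≠ 0 := fun y hy => by
    rw [soloInformed_aeval_swapK]; exact hU _ (soloInformed_swap_mem_cube hy)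
  have hF'' : ∀ y ∈ soloInformedCube 2, y ≠ 0 →
      (MvPolynomial.aeval y (soloInformedSwapK F) : ℝ) ≠ 0 := fun y hy hy0 => by
    rw [soloInformed_aeval_swapK]
    refine hF' _ (soloInformed_swap_mem_cube hy) fun h => hy0 ?_
    funext j
    fin_cases j
    · simpa using congr_fun h 1
    · simpa using congr_fun h 0
  have h := hF (Finsupp.mapDomain (Equiv.swap (0 : Fin 2) 1) e) u (soloInformedSwapK U) hu hU' hF''
  have heq : soloInformedSwapK (MvPolynomial.monomial e u * (U * F)) =
      MvPolynomial.monomial (Finsupp.mapDomain (Equiv.swap (0 : Fin 2) 1) e) u *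
        (soloInformedSwapK U * soloInformedSwapK F) := by
    rw [map_mul, map_mul]
    unfold soloInformedSwapK
    rw [MvPolynomial.rename_monomial]
  rw [heq]
  exact h

/-! ### RULE NORMALISE: rescaling the first coordinate -/

/-- **RULE NORMALISE.**  If `0 < λ₀ < 1` in `K` and `F(λ₀x₀, x₁)` has the vertex-germ property,
so does `F`. [this work] -/
theorem soloInformed_vertexGermOK_of_xScale (hK : ∀ c : K, IsAlgebraic ℚ (algebraMap K ℝ c))
    {F : MvPolynomial (Fin 2) K} {lam₀ : K} (h0 : 0 < algebraMap K ℝ lam₀)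
    (h1 : algebraMap K ℝ lam₀ < 1)
    (hF : SoloInformedVertexGermOK (soloInformedScaleSubstK 0 0 lam₀ F)) :
    SoloInformedVertexGermOK F := by
  intro e u U hu hU hF'
  set Q := MvPolynomial.monomial e u * (U * F) with hQdef
  have hmoveL : ∀ y ∈ soloInformedCube 2,
      soloInformedScaleMoveR 0 (algebraMap K ℝ 0) (algebraMap K ℝ lam₀) y ∈ soloInformedCube 2 := by
    intro y hy j
    by_cases hj : j = 0
    · subst hj
      rw [soloInformed_scaleMoveR_apply_self, map_zero, zero_add]
      exact ⟨mul_nonneg h0.le (hy 0).1, by nlinarith [(hy 0).2, (hy 0).1]⟩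
    · rw [soloInformed_scaleMoveR_apply_ne 0 _ _ y hj]; exact hy j
  have hmoveR : ∀ y ∈ soloInformedCube 2,
      soloInformedScaleMoveR 0 (algebraMap K ℝ lam₀) (algebraMap K ℝ (1 - lam₀)) y ∈
        soloInformedCube 2 ∧
      0 < soloInformedScaleMoveR 0 (algebraMap K ℝ lam₀) (algebraMap K ℝ (1 - lam₀)) y 0 := by
    intro y hy
    refine ⟨fun j => ?_, ?_⟩
    · by_cases hj : j = 0
      · subst hj
        rw [soloInformed_scaleMoveR_apply_self, map_sub, map_one]
        exact ⟨by nlinarith [(hy 0).1, (hy 0).2], by nlinarith [(hy 0).1, (hy 0).2]⟩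
      · rw [soloInformed_scaleMoveR_apply_ne 0 _ _ y hj]; exact hy j
    · rw [soloInformed_scaleMoveR_apply_self, map_sub, map_one]
      nlinarith [(hy 0).1, (hy 0).2]
  have hQ : ∀ x ∈ soloInformedOpenCube 2, x 0 ≠ algebraMap K ℝ lam₀ →
      (MvPolynomial.aeval x Q : ℝ) ≠ 0 := fun x hx _ => by
    rw [hQdef, map_mul, map_mul, soloInformed_aevalK_monomial]
    exact mul_ne_zero (mul_ne_zero ((_root_.map_ne_zero _).2 hu)
      (Finset.prod_ne_zero_iff.2 fun j _ => pow_ne_zero _ (hx j).1.ne'))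
      (mul_ne_zero (hU x (soloInformedOpenCube_subset_cube 2 hx))
        (hF' x (soloInformedOpenCube_subset_cube 2 hx) fun h => (hx 0).1.ne' (by rw [h]; rfl)))
  refine soloInformed_presentableDenK_of_split hK 0 lam₀ h0 h1 hQ ?_ ?_
  · -- the near piece `Q(λ₀x₀, x₁) = u λ₀^{e₀} xᵉ · U(λ₀x₀, x₁) · F(λ₀x₀, x₁)`
    have hUL : ∀ y ∈ soloInformedCube 2,
        (MvPolynomial.aeval y (soloInformedScaleSubstK 0 0 lam₀ U) : ℝ) ≠ 0 := fun y hy => by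
      rw [soloInformed_aeval_scaleSubstK]; exact hU _ (hmoveL y hy)
    have hFL : ∀ y ∈ soloInformedCube 2, y ≠ 0 →
        (MvPolynomial.aeval y (soloInformedScaleSubstK 0 0 lam₀ F) : ℝ) ≠ 0 := fun y hy hy0 => by
      rw [soloInformed_aeval_scaleSubstK]
      refine hF' _ (hmoveL y hy) fun h => hy0 ?_
      funext j
      have hj := congr_fun h j
      by_cases hj0 : j = 0
      · subst hj0
        rw [soloInformed_scaleMoveR_apply_self, map_zero, zero_add] at hj
        simpa [h0.ne'] using hj
      · rw [soloInformed_scaleMoveR_apply_ne 0 _ _ y hj0] at hj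
        exact hj
    have h := hF e (u * lam₀ ^ e 0) (soloInformedScaleSubstK 0 0 lam₀ U)
      (mul_ne_zero hu (pow_ne_zero _ fun h => h0.ne' (by rw [h, map_zero]))) hUL hFL
    refine soloInformed_presentableDenK_congr (fun x hx => ?_) h
    rw [soloInformed_aeval_scaleSubstK, hQdef]
    simp only [map_mul, soloInformed_aevalK_monomial, soloInformed_aeval_scaleSubstK,
      Fin.prod_univ_two, soloInformed_scaleMoveR_apply_self,
      soloInformed_scaleMoveR_apply_ne 0 _ _ x (one_ne_zero : (1 : Fin 2) ≠ 0), map_zero, zero_add,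
      map_pow, mul_pow]
    ring
  · -- the far piece is a leaf: `x₁^{e₁}` times a unit
    set W := soloInformedScaleSubstK 0 lam₀ (1 - lam₀)
      (MvPolynomial.monomial (Finsupp.single 0 (e 0)) (1 : K) * (U * F)) with hWdef
    have hW : ∀ y ∈ soloInformedCube 2, (MvPolynomial.aeval y W : ℝ) ≠ 0 := fun y hy => by
      rw [hWdef, soloInformed_aeval_scaleSubstK, map_mul, map_mul, soloInformed_aevalK_monomial,
        map_one, one_mul, Fin.prod_univ_two]
      obtain ⟨hmem, hpos⟩ := hmoveR y hy
      refine mul_ne_zero (mul_ne_zero (pow_ne_zero _ hpos.ne') (by simp)) (mul_ne_zero (hU _ hmem)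
        (hF' _ hmem fun h => hpos.ne' ?_))
      rw [h]; rfl
    refine soloInformed_presentableDenK_congr (fun x hx => ?_)
      (soloInformed_presentableDenK_monomial_mul_of_forall_ne_zero hK (Finsupp.single 1 (e 1)) hu hW)
    rw [hWdef, soloInformed_aeval_scaleSubstK, hQdef]
    simp only [map_mul, soloInformed_aevalK_monomial, soloInformed_aeval_scaleSubstK,
      Fin.prod_univ_two, map_one, one_mul,
      soloInformed_scaleMoveR_apply_ne 0 _ _ x (one_ne_zero : (1 : Fin 2) ≠ 0),
      Finsupp.single_eq_same, Finsupp.single_eq_of_ne (one_ne_zero : (1 : Fin 2) ≠ 0),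
      Finsupp.single_eq_of_ne (zero_ne_one : (0 : Fin 2) ≠ 1), pow_zero, mul_one, one_mul]
    ring

/-! ### The rescaled polynomial `F(λ₀x₀, x₁)` -/

omit [Algebra K ℝ] in
/-- Rescaling a coordinate multiplies each monomial by a power of the scale. [this work] -/
theorem soloInformed_scaleSubstK_zero_monomial (i : Fin 2) (b : K) (d : Fin 2 →₀ ℕ) (r : K) :
    soloInformedScaleSubstK i 0 b (MvPolynomial.monomial d r) =
      MvPolynomial.monomial d (r * b ^ d i) := by
  classical
  unfold soloInformedScaleSubstK
  rw [MvPolynomial.bind₁_monomial]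
  have hf : ∀ j ∈ d.support, ((if j = i then MvPolynomial.C 0 + MvPolynomial.C b * MvPolynomial.X j
      else MvPolynomial.X j : MvPolynomial (Fin 2) K)) ^ d j =
      MvPolynomial.C ((if j = i then b else 1) ^ d j) * MvPolynomial.X j ^ d j := by
    intro j _
    split_ifs
    · rw [MvPolynomial.C_0, zero_add, mul_pow, map_pow]
    · rw [one_pow, MvPolynomial.C_1, one_mul]
  rw [Finset.prod_congr rfl hf, Finset.prod_mul_distrib, ← map_prod]
  have hb : (∏ j ∈ d.support, (if j = i then b else 1) ^ d j) = b ^ d i := by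
    rw [Finset.prod_congr rfl fun j _ => (show (if j = i then b else 1) ^ d j =
      if j = i then b ^ d j else 1 by split_ifs <;> simp), Finset.prod_ite_eq']
    split_ifs with h
    · rfl
    · rw [Finsupp.notMem_support_iff.1 h, pow_zero]
  rw [hb, MvPolynomial.monomial_eq, MvPolynomial.C_mul, Finsupp.prod]
  ring

omit [Algebra K ℝ] in
/-- Coefficients of the rescaled polynomial. [this work] -/
theorem soloInformed_coeff_scaleSubstK_zero (i : Fin 2) (b : K) (F : MvPolynomial (Fin 2) K)
    (d : Fin 2 →₀ ℕ) :
    MvPolynomial.coeff d (soloInformedScaleSubstK i 0 b F) = MvPolynomial.coeff d F * b ^ d i := by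
  classical
  conv_lhs => rw [F.as_sum, map_sum]
  rw [MvPolynomial.coeff_sum]
  simp only [soloInformed_scaleSubstK_zero_monomial, MvPolynomial.coeff_monomial]
  rw [Finset.sum_ite_eq']
  split_ifs with h
  · rfl
  · rw [MvPolynomial.notMem_support_iff.1 h, zero_mul]

omit [Algebra K ℝ] in
/-- The support is unchanged by a non-zero rescaling. [this work] -/
theorem soloInformed_support_scaleSubstK_zero (i : Fin 2) {b : K} (hb : b ≠ 0)
    (F : MvPolynomial (Fin 2) K) : (soloInformedScaleSubstK i 0 b F).support = F.support := by
  ext d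
  rw [MvPolynomial.mem_support_iff, MvPolynomial.mem_support_iff,
    soloInformed_coeff_scaleSubstK_zero]
  exact ⟨fun h h0 => h (by rw [h0, zero_mul]), fun h => mul_ne_zero h (pow_ne_zero _ hb)⟩

omit [Algebra K ℝ] in
/-- The cone polynomial of the rescaled polynomial: `cone_{F(λ₀·,·)} = c (X − λ₀θ)^m` when
`cone_F = c (X − θ)^m`. [this work] -/
theorem soloInformed_conePolyK_xScale_of_pow {F : MvPolynomial (Fin 2) K} {m : ℕ}
    (hm : ∀ a ∈ F.support, m ≤ a 0 + a 1) {lam₀ : K} (hlam₀ : lam₀ ≠ 0) {c θ : K}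
    (h : soloInformedConePolyK F m = C c * (X - C θ) ^ m) :
    soloInformedConePolyK (soloInformedScaleSubstK 0 0 lam₀ F) m = C c * (X - C (lam₀ * θ)) ^ m := by
  have hm' : ∀ a ∈ (soloInformedScaleSubstK 0 0 lam₀ F).support, m ≤ a 0 + a 1 := by
    rw [soloInformed_support_scaleSubstK_zero 0 hlam₀]; exact hm
  ext k
  rw [soloInformed_coeff_conePolyK _ hm', sub_eq_add_neg, ← map_neg C, Polynomial.coeff_C_mul,
    Polynomial.coeff_X_add_C_pow]
  by_cases hk : k ≤ m
  · have hF := soloInformed_coeff_conePolyK F hm k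
    rw [h, if_pos hk, sub_eq_add_neg, ← map_neg C, Polynomial.coeff_C_mul,
      Polynomial.coeff_X_add_C_pow] at hF
    rw [if_pos hk, soloInformed_coeff_scaleSubstK_zero, (soloInformed_single_add_single_apply _ _).1,
      ← hF, neg_mul_eq_mul_neg, mul_pow]
    ring
  · rw [if_neg hk, Nat.choose_eq_zero_of_lt (not_le.1 hk), Nat.cast_zero, mul_zero, mul_zero]

/-- Values of the blow-up chart as a sum over the support. [this work] -/
theorem soloInformed_aeval_blowLowK_eq_sum (G : MvPolynomial (Fin 2) K) (m : ℕ)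
    (v : Fin 2 → ℝ) :
    (MvPolynomial.aeval v (soloInformedBlowLowK G m) : ℝ) =
      ∑ a ∈ G.support, algebraMap K ℝ (MvPolynomial.coeff a G) *
        (v 0 ^ (a 0 + a 1 - m) * v 1 ^ a 1) := by
  rw [soloInformed_blowLowK_eq_sum, map_sum]
  refine Finset.sum_congr rfl fun a _ => ?_
  rw [soloInformed_aevalK_monomial, Fin.prod_univ_two, (soloInformed_single_add_single_apply _ _).1,
    (soloInformed_single_add_single_apply _ _).2]

/-- **Values of the blow-up chart of the rescaled polynomial**:
`(F(λ₀·,·))_low(v) = λ₀^m F_low(λ₀v₀, v₁/λ₀)`. [this work] -/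
theorem soloInformed_aeval_blowLowK_xScale (F : MvPolynomial (Fin 2) K) {m : ℕ}
    (hm : ∀ a ∈ F.support, m ≤ a 0 + a 1) {lam₀ : K} (hlam₀ : algebraMap K ℝ lam₀ ≠ 0)
    (v : Fin 2 → ℝ) :
    (MvPolynomial.aeval v (soloInformedBlowLowK (soloInformedScaleSubstK 0 0 lam₀ F) m) : ℝ) =
      algebraMap K ℝ lam₀ ^ m * MvPolynomial.aeval
        ![algebraMap K ℝ lam₀ * v 0, (algebraMap K ℝ lam₀)⁻¹ * v 1] (soloInformedBlowLowK F m) := by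
  have hlam₀' : lam₀ ≠ 0 := fun h => hlam₀ (by rw [h, map_zero])
  rw [soloInformed_aeval_blowLowK_eq_sum, soloInformed_aeval_blowLowK_eq_sum,
    soloInformed_support_scaleSubstK_zero 0 hlam₀', Finset.mul_sum]
  refine Finset.sum_congr rfl fun a ha => ?_
  rw [soloInformed_coeff_scaleSubstK_zero, map_mul, map_pow]
  simp only [Matrix.cons_val_zero, Matrix.cons_val_one]
  set L := algebraMap K ℝ lam₀
  have hma := hm a ha
  have hpow : L ^ m * (L ^ (a 0 + a 1 - m) * L⁻¹ ^ a 1) = L ^ a 0 := by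
    rw [← mul_assoc, ← pow_add, show m + (a 0 + a 1 - m) = a 0 + a 1 by omega, pow_add,
      mul_assoc, ← mul_pow, mul_inv_cancel₀ hlam₀, one_pow, mul_one]
  rw [mul_pow, mul_pow, ← hpow]
  ring

/-- **Child germs of the rescaled polynomial** are constant multiples of child germs of `F`:
`child_{F(λ₀·,·)}(t, κ, λ) = λ₀^m · child_F(t/λ₀, λ₀κ, λ/λ₀)`. [this work] -/
theorem soloInformed_aeval_childK_xScale (F : MvPolynomial (Fin 2) K) {m : ℕ}
    (hm : ∀ a ∈ F.support, m ≤ a 0 + a 1) {lam₀ : K} (hlam₀ : algebraMap K ℝ lam₀ ≠ 0)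
    (t κ lam : K) (x : Fin 2 → ℝ) :
    (MvPolynomial.aeval x (soloInformedChildK (soloInformedScaleSubstK 0 0 lam₀ F) m t κ lam) : ℝ) =
      algebraMap K ℝ lam₀ ^ m * MvPolynomial.aeval x
        (soloInformedChildK F m (lam₀⁻¹ * t) (lam₀ * κ) (lam₀⁻¹ * lam)) := by
  rw [soloInformed_aeval_childK, soloInformed_aeval_blowLowK_xScale F hm hlam₀,
    soloInformed_aeval_childK]
  have hpt : (![algebraMap K ℝ lam₀ * (![algebraMap K ℝ κ * x 0, algebraMap K ℝ t +
      algebraMap K ℝ lam * x 1] : Fin 2 → ℝ) 0, (algebraMap K ℝ lam₀)⁻¹ *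
      (![algebraMap K ℝ κ * x 0, algebraMap K ℝ t + algebraMap K ℝ lam * x 1] : Fin 2 → ℝ) 1] :
        Fin 2 → ℝ) =
      ![algebraMap K ℝ (lam₀ * κ) * x 0,
        algebraMap K ℝ (lam₀⁻¹ * t) + algebraMap K ℝ (lam₀⁻¹ * lam) * x 1] := by
    funext j
    fin_cases j
    · simp [map_mul]; ring
    · simp [map_mul, map_inv₀]; ring
  rw [hpt]

end Summit.KontsevichZagierPeriods.KontsevichZagierPeriods.Theorems
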